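import Mathlib
import HarnessLib
import Summits.ValiantsHypothesis.ValiantsHypothesis.Theses.MonotoneRestoration

/-! # Route MonotoneRestoration — crux `MonotoneRestorationQP`, line Sketch, stub N3
(stmt-ValiantsHypothesis-15886)

**Coordinates are `ℚ`-linear in the coefficients.** If `b₀, …, b_{M-1} ∈ ℚ[X]` are
`ℚ`-linearly independent and `f = Σ_i c_i · b_i` (computed in `ℂ[X]`, `c_i ∈ ℂ`) has all its
coefficients in a `ℚ`-subalgebra `S ⊆ ℂ`, then every coordinate `c_i` lies in `S`.

Proof (linear algebra over `ℚ`, no topology): the `ℚ`-linear map `v ↦ Σ_i v_i b_i`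
(`Finsupp.linearCombination ℚ b`) is injective (`hb`), so it has a `ℚ`-linear left inverse `L`
(`LinearMap.exists_leftInverse_of_injective`). Expanding each `b_j` over the finite set `T` of
monomials occurring in the family, `c_i = Σ_{m ∈ T} coeff_m(f) · L(X^m)_i`: a finite sum of
(coefficient of `f`) × (rational number), hence an element of `S`.
-/

noncomputable section

-- `Summit.ValiantsHypothesis.ValiantsHypothesis.…` is the tree's mandated namespace (Sub = Summit).
set_option linter.dupNamespace false

namespace Summit.ValiantsHypothesis.ValiantsHypothesis.Theorems

open MvPolynomial

/-- **N3 — COORDINATES ARE `ℚ`-LINEAR IN THE COEFFICIENTS** (crux `MonotoneRestorationQP`, line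
Sketch; registered stub `stub_coords_mem_of_coeffs_mem`). If `b_0, …, b_{M-1} ∈ ℚ[X]` are
`ℚ`-linearly independent and `f = Σ_i c_i · b_i` (in `ℂ[X]`) has all its coefficients in a
`ℚ`-subalgebra `S ⊆ ℂ`, then every `c_i ∈ S`: each `c_i` is a finite `ℚ`-combination of
coefficients of `f`, obtained from a `ℚ`-linear left inverse of `v ↦ Σ v_i b_i`. [folklore] -/
theorem stub_coords_mem_of_coeffs_mem {X : Type} {M : ℕ} (b : Fin M → MvPolynomial X ℚ)
    (hb : LinearIndependent ℚ b) (S : Subalgebra ℚ ℂ) (c : Fin M → ℂ)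
    (hf : ∀ m, MvPolynomial.coeff m (∑ i, c i • MvPolynomial.map (algebraMap ℚ ℂ) (b i)) ∈ S) :
    ∀ i, c i ∈ S := by
  classical
  -- (1) a `ℚ`-linear left inverse `L` of `v ↦ Σ_j v_j b_j`
  obtain ⟨L, hL⟩ := (Finsupp.linearCombination ℚ b).exists_leftInverse_of_injective
    (linearIndependent_iff_ker.mp hb)
  have hLb : ∀ j, L (b j) = Finsupp.single j 1 := fun j => by
    have h := LinearMap.congr_fun hL (Finsupp.single j 1)
    simpa [Finsupp.linearCombination_single] using h
  -- (2) the finite set of monomials occurring in the family `b`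
  set T : Finset (X →₀ ℕ) := Finset.univ.biUnion fun j => (b j).support
  have hbT : ∀ j, b j = ∑ m ∈ T, coeff m (b j) • monomial m (1 : ℚ) := by
    intro j
    have hsub : (b j).support ⊆ T :=
      Finset.subset_biUnion_of_mem (fun j => (b j).support) (Finset.mem_univ j)
    calc b j = ∑ m ∈ (b j).support, monomial m (coeff m (b j)) := (b j).as_sum
      _ = ∑ m ∈ (b j).support, coeff m (b j) • monomial m (1 : ℚ) := by
          refine Finset.sum_congr rfl fun m _ => ?_
          rw [smul_monomial, smul_eq_mul, mul_one]
      _ = ∑ m ∈ T, coeff m (b j) • monomial m (1 : ℚ) := by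
          refine Finset.sum_subset hsub fun m _ hm => ?_
          rw [notMem_support_iff.mp hm, zero_smul]
  intro i
  -- (3) `L(b_j)_i = Σ_{m ∈ T} coeff_m(b_j) · L(X^m)_i`
  have hLsum : ∀ j, ∑ m ∈ T, coeff m (b j) * L (monomial m 1) i = (Finsupp.single j (1 : ℚ)) i := by
    intro j
    rw [← hLb j]
    conv_rhs => rw [hbT j, map_sum, Finsupp.finsetSum_apply]
    refine Finset.sum_congr rfl fun m _ => ?_
    rw [map_smul, Finsupp.smul_apply, smul_eq_mul]
  -- (4) the coefficients of `f`
  have hcoeff : ∀ m, coeff m (∑ j, c j • map (algebraMap ℚ ℂ) (b j)) =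
      ∑ j, c j * algebraMap ℚ ℂ (coeff m (b j)) := by
    intro m
    rw [coeff_sum]
    refine Finset.sum_congr rfl fun j _ => ?_
    rw [coeff_smul, coeff_map, smul_eq_mul]
  -- (5) the key identity: `c_i = Σ_{m ∈ T} coeff_m(f) · L(X^m)_i`
  have key : c i = ∑ m ∈ T, coeff m (∑ j, c j • map (algebraMap ℚ ℂ) (b j)) *
      algebraMap ℚ ℂ (L (monomial m 1) i) := by
    simp_rw [hcoeff, Finset.sum_mul]
    rw [Finset.sum_comm]
    have hj : ∀ j, ∑ m ∈ T, c j * algebraMap ℚ ℂ (coeff m (b j)) *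
        algebraMap ℚ ℂ (L (monomial m 1) i) = c j * algebraMap ℚ ℂ (Finsupp.single j (1 : ℚ) i) := by
      intro j
      rw [← hLsum j, map_sum, Finset.mul_sum]
      refine Finset.sum_congr rfl fun m _ => ?_
      rw [map_mul, mul_assoc]
    simp_rw [hj]
    rw [Finset.sum_eq_single i (fun j _ hj' => by
      rw [Finsupp.single_eq_of_ne' hj', map_zero, mul_zero]) (fun h => absurd (Finset.mem_univ i) h),
      Finsupp.single_eq_same, map_one, mul_one]
  rw [key]
  exact S.sum_mem fun m _ => S.mul_mem (hf m) (S.algebraMap_mem _)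

end Summit.ValiantsHypothesis.ValiantsHypothesis.Theorems

end
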